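import Summits.QuantumFields.BalabanUV.T4Continuum.Support.BlockAveragePushDirSplit
import Summits.QuantumFields.BalabanUV.T4Continuum.Support.AveragingDeficitMultiLevelPrep
import Summits.QuantumFields.BalabanUV.T4Continuum.Support.MinimalActionWitness
import HarnessLib

/-!
# T⁴ programme, node NE3, row NE3-R2 (gen 5) — THE FLAT-BACKGROUND PUSH-FORWARD OF SLAB WAVES: an explicit family of
# CONSTRAINT-TANGENT directions for the `k`-fold average (42) at the flat configuration (`NE3TangentFlatPush`)

Cell `pub-balaban`, unit `b2b-balaban-t4-ne3r2-p1` (OWNER of `BINDER-OWNERS.md` row NE3-R2 «T⁴ spine exit NE3-R2»), gen 5.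
WHY.  The energy route of NE3 (road P2, typed root `NE3EnergyShapes.NE3EnergyRate`, assembly
`NE3EnergyAssembly.ne3EnergyRate_of_routeLeaves`) needs its leaf L5 = ML, «tangent coercivity of the Wilson Hessian»
(`NE3HessShapes.TangentCoercive W T N c`: `c·(curlSq + dirSq) ≤ hess` in LATTICE units), with ONE constant `c > 0` for all
levels `k`, on the tangent space `T(W)` of the `k`-fold averaging constraint (tree: `AveragingDeficitMultiLevelPrep.TangentIter
L (k−1) W`, this row's gen 3) cut by a Landau condition.  The companion file `NE3CoercivityScaling` shows this is IMPOSSIBLE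
already at the flat background, by exhibiting tangent, divergence-free SLAB WAVES of wavelength `L^k`.  THIS FILE supplies the
kinematic half: the slab waves ARE constraint-tangent.  All [folklore], 0 sorry; nothing of Bałaban's is asserted.

WHAT IS PROVED (flat background `flatCfg ≡ 1`, any `d`, two directions `i₀ ≠ i₁`, any matrix `E`):
* §1 `slabWave i₀ i₁ s E (x, μ) = [μ = i₀]·s(x_{i₁})·E` (a direction field along `e_{i₀}` whose profile depends on the
  coordinate `x_{i₁}` only) and the block sums `bsum L s u = Σ_{t<L} s(Lu + t)`; elementary invariances of the abelian
  contour sum `asum` (`asum_add'`, `asum_of_shift_invariant`), the telescoping of flat pure gauges along words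
  (`asum_gaugeDir_flatCfg`), the straight-segment sums of a slab wave (`asum_seg_slabWave`), and the fibre count
  `Σ_{r : Fin d → Fin L} g(r i) = L^{d−1}·Σ_a g(a)` (`sum_fun_apply_eq`).
* §2 AT THE FLAT BACKGROUND THE LINEARISED AVERAGE (42) IS `T_c = (frame gauge) + L·Q₀` (tree, BY NAME:
  `BlockAveragePushDirSplit.pushDir_flat`, `B7Prop3Flat.frame_cancellation`), hence on the coarse unit lattice
  (`cpush`, this row's gen 3): **`cpush_flatCfg_gaugeDir`** — a flat pure gauge `gaugeDir 1 Λ` is pushed to the flat pure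
  gauge of `Λ ∘ (L·)`; **`cpush_flatCfg_slabWave`** — a slab wave of profile `s` is pushed to the slab wave of profile
  `bsum L s` PLUS a flat pure gauge `gaugeDir 1 Φ` whose potential `Φ` (the block frames `F̂` read on the coarse lattice)
  depends on `x_{i₁}` only and inherits the period of `s` divided by `L`; `cpush` is additive at the flat background.
* §3 **`tangentIter_flatCfg_slabWave_add_gaugeDir`** (induction on the tower): for `s` of period `L^{j+1}` with zero
  period sum and `Λ` depending on `x_{i₁}` only with period `L^{j+1}` in `x_{i₁}`, the direction `slabWave s E + gaugeDir 1 Λ`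
  is tangent to the fibre of the `(j+1)`-fold average at the flat configuration (`TangentIter L j flatCfg`); in particular
  **`tangentIter_flatCfg_slabWave`**: every slab wave whose profile has period `L^k` and zero period sum lies in the
  tangent space `T(1)` of run A's constraint at level `k` (`TangentIter L (k−1) flatCfg`), for every `k ≥ 1`.
MECHANISM: `L·Q₀` sees only straight segments (block sums); the tree contours contribute frames = pure gauges, pushed to
pure gauges; at the top the profile has period `1` and zero sum (vanishes) and the potential is constant (gauge vanishes).
HONEST FRAMING.  Finite-`T⁴` kinematics at ONE (flat) configuration; rung (B)+1 bookkeeping; NOT infinite volume, NOT a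
mass gap, NOT Clay, NOT summit progress; NE3 is NOT proved and nothing printed is asserted or refuted (context only:
[Balaban1985Averaging] (42) p. 23, (47)–(48) p. 25, (122)∕(125) p. 36; [Balaban1985Variational] (83) p. 290 — the tangent
space `T = ker DQ̄_k`).  ABSOLUTE RULE kept: no printed sentence is a hypothesis.  PLACEMENT (human rule 2026-08-19): our
work, under `Summits/QuantumFields/BalabanUV/`; imports accepted tree modules only; restates nothing, moves nothing.
Record: HOME `t4/T4-EST-NE3-R2.md` v0.6.
-/

set_option autoImplicit false

open scoped BigOperators Matrix.Norms.L2Operator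
open NormedSpace Finset

namespace Summit.QuantumFields.BalabanUV.T4Continuum.NE3TangentFlatPush

open Literature.MathematicalPhysics.QuantumFieldTheory.Balaban1983to89
open B7Prop1Explicit B7Prop2Explicit MatrixLog UnitaryModel
open T4AveragingDeficitWall hiding Site Plane Plaq Bond
open AveragingDeficitResidualPairing (pushDir)
open AveragingDeficitChartCalculus (cavg)
open AveragingDeficitMultiLevelPrep (cpush TangentIter)
open B7Prop3Flat (Fhat linQ frame_cancellation)
open BlockAveragePushDirGauge (gaugeDir)
open BlockAveragePushDirSplit (pushDir_flat sum_blockWeight_eq_one)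
open MinimalActionWitness (flatCfg)

noncomputable section

variable {d : ℕ} {n : Type*} [Fintype n] [DecidableEq n]

/-! ## §1 Slab waves, block sums, and elementary facts about the abelian contour sum -/

/-- THE SLAB WAVE of profile `s` along `e_{i₀}`, varying along `e_{i₁}`: `X(x, μ) = [μ = i₀]·s(x_{i₁})·E`. [folklore] -/
def slabWave (i₀ i₁ : Fin d) (s : ℤ → ℝ) (E : Matrix n n ℂ) : Site d → Fin d → Matrix n n ℂ :=
  fun x μ => (if μ = i₀ then s (x i₁) else 0) • E

/-- The block sums of a profile: `bsum L s u = Σ_{t<L} s(Lu + t)`. [folklore] -/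
def bsum (L : ℕ) (s : ℤ → ℝ) : ℤ → ℝ := fun u => ∑ t ∈ Finset.range L, s ((L : ℤ) * u + (t : ℤ))

omit [Fintype n] [DecidableEq n] in
/-- The slab wave of the zero profile vanishes. [folklore] -/
theorem slabWave_zero_profile (i₀ i₁ : Fin d) (E : Matrix n n ℂ) {s : ℤ → ℝ} (hs : ∀ t, s t = 0) :
    slabWave i₀ i₁ s E = 0 := by
  funext x μ; simp [slabWave, hs]

omit [Fintype n] [DecidableEq n] in
/-- A slab wave is invariant under translations that do not move the `i₁`-coordinate. [folklore] -/
theorem slabWave_shift (i₀ i₁ : Fin d) (s : ℤ → ℝ) (E : Matrix n n ℂ) {v : Site d} (hv : v i₁ = 0) (x : Site d) (μ : Fin d) :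
    slabWave i₀ i₁ s E (x + v) μ = slabWave i₀ i₁ s E x μ := by
  simp [slabWave, hv]

omit [Fintype n] [DecidableEq n] in
/-- A slab wave with an `m`-periodic profile is `m e_{i₁}`-periodic. [folklore] -/
theorem slabWave_shift_period (i₀ i₁ : Fin d) {s : ℤ → ℝ} {m : ℤ} (hs : ∀ t, s (t + m) = s t) (E : Matrix n n ℂ) (x : Site d)
    (μ : Fin d) : slabWave i₀ i₁ s E (x + m • e i₁) μ = slabWave i₀ i₁ s E x μ := by
  simp [slabWave, e_apply, hs]

omit [Fintype n] [DecidableEq n] in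
/-- Shifting by a multiple of the period. [folklore] -/
theorem shift_mul_period {α : Type*} {s : ℤ → α} {m : ℤ} (hs : ∀ t, s (t + m) = s t) (c t : ℤ) :
    s (t + c * m) = s t := by
  have h := (show Function.Periodic s m from hs).zsmul c
  simpa [zsmul_eq_mul] using h t

omit [Fintype n] [DecidableEq n] in
/-- A slab wave with an `m`-periodic profile is a periodic direction field of every period `c·m`. [folklore] -/
theorem isPeriodicDir_slabWave (i₀ i₁ : Fin d) {s : ℤ → ℝ} {m : ℤ} (hs : ∀ t, s (t + m) = s t) (E : Matrix n n ℂ) (c : ℤ) :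
    AveragingDeficitPeriodicCounting.IsPeriodicDir (slabWave i₀ i₁ s E) (c * m) := by
  intro x κ μ
  by_cases hκ : κ = i₁
  · subst hκ
    simp [slabWave, e_apply, shift_mul_period hs]
  · simp [slabWave, e_apply, Ne.symm hκ]

/-- The abelian contour sum is additive in the field. [folklore] -/
theorem asum_add' (A B : Site d → Fin d → Matrix n n ℂ) : ∀ (x : Site d) (w : List (Letter d)),
    asum (A + B) x w = asum A x w + asum B x w
  | x, [] => by simp
  | x, l :: w => by
      rw [asum_cons, asum_cons, asum_cons, asum_add' A B (x + l.vec) w]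
      obtain ⟨μ, b⟩ := l
      cases b <;> simp [stepA] <;> abel

/-- A field invariant under the translation `v` has translation-invariant contour sums. [folklore] -/
theorem asum_of_shift_invariant (A : Site d → Fin d → Matrix n n ℂ) {v : Site d} (hA : ∀ x μ, A (x + v) μ = A x μ) :
    ∀ (x : Site d) (w : List (Letter d)), asum A (x + v) w = asum A x w
  | x, [] => by simp
  | x, l :: w => by
      rw [asum_cons, asum_cons, show x + v + l.vec = (x + l.vec) + v by abel, asum_of_shift_invariant A hA (x + l.vec) w]
      obtain ⟨μ, b⟩ := l
      cases b
      · simp only [stepA, Letter.vec, if_false, Bool.false_eq_true]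
        rw [show x + v + -e μ = (x + -e μ) + v by abel, hA]
      · simp only [stepA, if_true]
        rw [hA]

/-- At the flat configuration a pure gauge is minus the forward difference of its potential. [folklore] -/
theorem gaugeDir_flatCfg (Λ : Site d → Matrix n n ℂ) (x : Site d) (μ : Fin d) :
    gaugeDir (flatCfg (d := d) (n := n)) Λ x μ = Λ x - Λ (x + e μ) := by
  simp [gaugeDir, flatCfg, Ad]

/-- The contour sum of a flat pure gauge telescopes: `(gaugeDir 1 Λ)(Γ) = Λ(start) − Λ(end)`. [folklore] -/
theorem asum_gaugeDir_flatCfg (Λ : Site d → Matrix n n ℂ) : ∀ (x : Site d) (w : List (Letter d)),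
    asum (gaugeDir (flatCfg (d := d) (n := n)) Λ) x w = Λ x - Λ (x + disp w)
  | x, [] => by simp
  | x, l :: w => by
      rw [asum_cons, asum_gaugeDir_flatCfg Λ (x + l.vec) w, disp_cons, ← add_assoc]
      obtain ⟨μ, b⟩ := l
      cases b
      · simp only [stepA, Letter.vec, if_false, Bool.false_eq_true, gaugeDir_flatCfg]
        rw [show x + -e μ + e μ = x by abel]
        abel
      · simp only [stepA, if_true, gaugeDir_flatCfg, Letter.vec]
        abel

/-- The straight-segment sum of a slab wave: `X([p, p + L e_κ]) = L·[κ = i₀]·s(p_{i₁})·E` (`i₀ ≠ i₁`). [folklore] -/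
theorem asum_seg_slabWave {i₀ i₁ : Fin d} (h01 : i₀ ≠ i₁) (s : ℤ → ℝ) (E : Matrix n n ℂ) (p : Site d) (κ : Fin d) (L : ℕ) :
    asum (slabWave i₀ i₁ s E) p (seg κ L) = ((L : ℝ) * (if κ = i₀ then s (p i₁) else 0)) • E := by
  rw [asum_seg_natCast]
  by_cases hκ : κ = i₀
  · subst hκ
    have hterm : ∀ i ∈ Finset.range L, slabWave κ i₁ s E (p + (i : ℤ) • e κ) κ = s (p i₁) • E := by
      intro i _
      simp [slabWave, e_apply, Ne.symm h01]
    rw [Finset.sum_congr rfl hterm, Finset.sum_const, Finset.card_range, ← Nat.cast_smul_eq_nsmul ℝ, smul_smul]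
    simp
  · have hterm : ∀ i ∈ Finset.range L, slabWave i₀ i₁ s E (p + (i : ℤ) • e κ) κ = 0 := by
      intro i _
      simp [slabWave, hκ]
    rw [Finset.sum_congr rfl hterm, Finset.sum_const_zero]
    simp [hκ]

/-- THE FIBRE COUNT: `Σ_{r : Fin d → Fin L} g(r i) = L^{d−1} · Σ_{a : Fin L} g(a)`. [folklore] -/
theorem sum_fun_apply_eq (L : ℕ) (i : Fin d) (g : Fin L → ℝ) :
    ∑ r : Fin d → Fin L, g (r i) = (L : ℝ) ^ (d - 1) * ∑ a : Fin L, g a := by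
  rw [Fintype.sum_equiv (Equiv.funSplitAt i (Fin L)) (fun r => g (r i)) (fun p => g p.1) (fun r => rfl),
    Fintype.sum_prod_type, Finset.mul_sum]
  refine Finset.sum_congr rfl fun a _ => ?_
  dsimp only
  rw [Finset.sum_const, Finset.card_univ, nsmul_eq_mul, Fintype.card_fun, Fintype.card_fin]
  congr 1
  have hc : Fintype.card {j : Fin d // j ≠ i} = d - 1 := by
    simp [Fintype.card_subtype_compl, Fintype.card_fin]
  rw [hc, Nat.cast_pow]

/-- Block sums re-assemble the profile: `Σ_{u<M} bsum L s u = Σ_{t<LM} s t`. [folklore] -/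
theorem sum_range_bsum (L : ℕ) (s : ℤ → ℝ) : ∀ M : ℕ,
    ∑ u ∈ Finset.range M, bsum L s (u : ℤ) = ∑ t ∈ Finset.range (L * M), s (t : ℤ)
  | 0 => by simp
  | M + 1 => by
      rw [Finset.sum_range_succ, sum_range_bsum L s M, Nat.mul_succ, Finset.sum_range_add]
      congr 1

/-- Block sums of an `L·m`-periodic profile are `m`-periodic. [folklore] -/
theorem bsum_periodic (L : ℕ) {s : ℤ → ℝ} {m : ℤ} (hs : ∀ t, s (t + (L : ℤ) * m) = s t) (u : ℤ) :
    bsum L s (u + m) = bsum L s u := by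
  unfold bsum
  refine Finset.sum_congr rfl fun t _ => ?_
  rw [show (L : ℤ) * (u + m) + (t : ℤ) = ((L : ℤ) * u + (t : ℤ)) + (L : ℤ) * m by ring, hs]

/-! ## §2 The push-forward at the flat background: slab waves and pure gauges -/

section Flat

variable (L : ℕ)

/-- `flatCfg` is the flat configuration of `BlockAveragePushDirSplit`. [folklore] -/
theorem flatCfg_eq_flat : (flatCfg : Site d → Fin d → (Matrix n n ℂ)ˣ) = BlockAveragePushDirSplit.flat := rfl

/-- The block average of the flat configuration, read on the coarse lattice, is flat. [folklore] -/
theorem cavg_flatCfg : cavg L (flatCfg (d := d) (n := n)) = flatCfg := by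
  funext y κ
  show bavg L (fun (_ : Site d) (_ : Fin d) => (1 : (Matrix n n ℂ)ˣ)) ((L : ℤ) • y) κ = 1
  rw [bavg_flat]

/-- **At the flat background the coarse push-forward is Bałaban's first-order term read on the coarse lattice**:
`cpush L 1 Y (z, κ) = T_{⟨Lz, Lz+Le_κ⟩}(Y) = F̂(Lz) − F̂(Lz + Le_κ) + L·(Q₀Y)` (tree `pushDir_flat` + `frame_cancellation`).
[cite: Balaban1985Averaging, (47)–(48) p.25, (122) + (125) p.36] -/
theorem cpush_flatCfg (hL : 1 ≤ L) (Y : Site d → Fin d → Matrix n n ℂ) (z : Site d) (κ : Fin d) :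
    cpush L flatCfg Y z κ
      = (Fhat L Y ((L : ℤ) • z) - Fhat L Y ((L : ℤ) • z + (L : ℤ) • e κ)) + linQ L Y ((L : ℤ) • z) κ := by
  show pushDir L flatCfg Y ((L : ℤ) • z) κ = _
  rw [flatCfg_eq_flat, pushDir_flat L hL, ← frame_cancellation L Y ((L : ℤ) • z) κ]
  abel

/-- `T_c` is additive in the direction. [folklore] -/
theorem Tside_add (A B : Site d → Fin d → Matrix n n ℂ) (q : Site d) (κ : Fin d) :
    Tside L (A + B) q κ = Tside L A q κ + Tside L B q κ := by
  simp only [Tside, asum_add', smul_add, Finset.sum_add_distrib]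

/-- The coarse push-forward is additive at the flat background. [folklore] -/
theorem cpush_flatCfg_add (hL : 1 ≤ L) (A B : Site d → Fin d → Matrix n n ℂ) :
    cpush L flatCfg (A + B) = cpush L flatCfg A + cpush L flatCfg B := by
  funext z κ
  show pushDir L flatCfg (A + B) ((L : ℤ) • z) κ
    = pushDir L flatCfg A ((L : ℤ) • z) κ + pushDir L flatCfg B ((L : ℤ) • z) κ
  rw [flatCfg_eq_flat, pushDir_flat L hL, pushDir_flat L hL, pushDir_flat L hL, Tside_add]

/-- **THE AVERAGE OF A FLAT PURE GAUGE IS THE FLAT PURE GAUGE OF THE RESTRICTED POTENTIAL**: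
`cpush L 1 (gaugeDir 1 Λ) = gaugeDir 1 (Λ ∘ (L·))`. [cite: Balaban1985Averaging, (45) p.24] -/
theorem cpush_flatCfg_gaugeDir (hL : 1 ≤ L) (Λ : Site d → Matrix n n ℂ) :
    cpush L flatCfg (gaugeDir (flatCfg (d := d) (n := n)) Λ)
      = gaugeDir (flatCfg (d := d) (n := n)) (fun y => Λ ((L : ℤ) • y)) := by
  funext z κ
  show pushDir L flatCfg (gaugeDir flatCfg Λ) ((L : ℤ) • z) κ = _
  rw [flatCfg_eq_flat, pushDir_flat L hL, Tside]
  have hterm : ∀ r : Fin d → Fin L,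
      (((L : ℝ) ^ d)⁻¹ : ℝ) • asum (gaugeDir BlockAveragePushDirSplit.flat Λ) ((L : ℤ) • z) (gammaWord L κ (boxVec L r))
        = (((L : ℝ) ^ d)⁻¹ : ℝ) • (Λ ((L : ℤ) • z) - Λ ((L : ℤ) • z + (L : ℤ) • e κ)) := by
    intro r
    rw [← flatCfg_eq_flat, asum_gaugeDir_flatCfg, disp_gammaWord]
  rw [Finset.sum_congr rfl fun r _ => hterm r, ← Finset.sum_smul, sum_blockWeight_eq_one L hL, one_smul,
    ← flatCfg_eq_flat, gaugeDir_flatCfg, smul_add]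

/-- THE FRAME POTENTIAL of a slab wave read on the coarse lattice: `Φ(z) := F̂(L·z)`. [folklore] -/
def framePot (i₀ i₁ : Fin d) (s : ℤ → ℝ) (E : Matrix n n ℂ) (z : Site d) : Matrix n n ℂ :=
  Fhat L (slabWave i₀ i₁ s E) ((L : ℤ) • z)

/-- The frame potential of a slab wave depends on the `i₁`-coordinate only. [folklore] -/
theorem framePot_shift (i₀ i₁ : Fin d) (s : ℤ → ℝ) (E : Matrix n n ℂ) (z : Site d) {v : Site d} (hv : v i₁ = 0) :
    framePot L i₀ i₁ s E (z + v) = framePot L i₀ i₁ s E z := by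
  unfold framePot Fhat
  refine Finset.sum_congr rfl fun r _ => ?_
  rw [smul_add, asum_of_shift_invariant (slabWave i₀ i₁ s E) (v := (L : ℤ) • v)
    (fun x μ => slabWave_shift i₀ i₁ s E (by simp [hv]) x μ)]

/-- The frame potential of a slab wave with `L·m`-periodic profile is `m`-periodic in `z_{i₁}`. [folklore] -/
theorem framePot_periodic (i₀ i₁ : Fin d) {s : ℤ → ℝ} {m : ℤ} (hs : ∀ t, s (t + (L : ℤ) * m) = s t) (E : Matrix n n ℂ)
    (z : Site d) : framePot L i₀ i₁ s E (z + m • e i₁) = framePot L i₀ i₁ s E z := by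
  unfold framePot Fhat
  refine Finset.sum_congr rfl fun r _ => ?_
  rw [smul_add, smul_smul, show (L : ℤ) • z + ((L : ℤ) * m) • e i₁ = (L : ℤ) • z + ((L : ℤ) * m) • e i₁ from rfl,
    asum_of_shift_invariant (slabWave i₀ i₁ s E) (v := ((L : ℤ) * m) • e i₁)
      (fun x μ => slabWave_shift_period i₀ i₁ hs E x μ)]

/-- `L·Q₀` maps a slab wave to the slab wave of the block sums (read on the coarse lattice). [folklore] -/
theorem linQ_slabWave (hL : 1 ≤ L) {i₀ i₁ : Fin d} (h01 : i₀ ≠ i₁) (s : ℤ → ℝ) (E : Matrix n n ℂ) (z : Site d) (κ : Fin d) :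
    linQ L (slabWave i₀ i₁ s E) ((L : ℤ) • z) κ = slabWave i₀ i₁ (bsum L s) E z κ := by
  unfold linQ
  simp only [asum_seg_slabWave h01]
  by_cases hκ : κ = i₀
  · subst hκ
    simp only [if_true, slabWave]
    have hcoord : ∀ r : Fin d → Fin L, ((L : ℤ) • z + boxVec L r) i₁ = (L : ℤ) * z i₁ + ((r i₁ : ℕ) : ℤ) := by
      intro r; simp [boxVec]
    simp only [hcoord, smul_smul, ← Finset.sum_smul]
    congr 1
    rw [show (∑ r : Fin d → Fin L, ((L : ℝ) ^ d)⁻¹ * ((L : ℝ) * s ((L : ℤ) * z i₁ + ((r i₁ : ℕ) : ℤ))))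
        = ((L : ℝ) ^ d)⁻¹ * (L : ℝ) * ∑ r : Fin d → Fin L, s ((L : ℤ) * z i₁ + ((r i₁ : ℕ) : ℤ)) by
          rw [Finset.mul_sum]; refine Finset.sum_congr rfl fun r _ => ?_; ring,
      sum_fun_apply_eq L i₁ (fun a : Fin L => s ((L : ℤ) * z i₁ + ((a : ℕ) : ℤ))), bsum,
      ← Fin.sum_univ_eq_sum_range (fun t : ℕ => s ((L : ℤ) * z i₁ + (t : ℤ))) L]
    have hL0 : (L : ℝ) ≠ 0 := by exact_mod_cast (by omega : L ≠ 0)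
    have hpow : ((L : ℝ) ^ d)⁻¹ * (L : ℝ) * (L : ℝ) ^ (d - 1) = 1 := by
      have hd : 0 < d := Fin.pos i₁
      rw [show d = (d - 1) + 1 by omega, pow_succ, Nat.add_sub_cancel]
      field_simp
    rw [← mul_assoc, hpow, one_mul]
  · simp [hκ, slabWave]

/-- **THE PUSH-FORWARD OF A SLAB WAVE AT THE FLAT BACKGROUND**: the slab wave of the block sums plus the flat pure gauge
of the frame potential. [cite: Balaban1985Averaging, (47)–(48) p.25, (122) + (125) p.36] -/
theorem cpush_flatCfg_slabWave (hL : 1 ≤ L) {i₀ i₁ : Fin d} (h01 : i₀ ≠ i₁) (s : ℤ → ℝ) (E : Matrix n n ℂ) :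
    cpush L flatCfg (slabWave i₀ i₁ s E)
      = slabWave i₀ i₁ (bsum L s) E + gaugeDir (flatCfg (d := d) (n := n)) (framePot L i₀ i₁ s E) := by
  funext z κ
  rw [cpush_flatCfg L hL, Pi.add_apply, Pi.add_apply, gaugeDir_flatCfg, linQ_slabWave L hL h01, framePot, framePot,
    smul_add]
  abel

end Flat

/-! ## §3 Tangency of slab waves to the fibre of the iterated average at the flat configuration -/

/-- A site function depending on `x_{i₁}` only and `1`-periodic in `x_{i₁}` is constant. [folklore] -/
theorem const_of_shift_and_periodic_one {α : Type*} (i₁ : Fin d) (Λ : Site d → α)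
    (hshift : ∀ (z v : Site d), v i₁ = 0 → Λ (z + v) = Λ z) (hper : ∀ z : Site d, Λ (z + (1 : ℤ) • e i₁) = Λ z)
    (z : Site d) (μ : Fin d) : Λ (z + e μ) = Λ z := by
  by_cases hμ : μ = i₁
  · subst hμ; simpa using hper z
  · exact hshift z (e μ) (by simp [e_apply, Ne.symm hμ])

/-- **TANGENCY, GENERAL STEP OF THE TOWER.**  For a profile `s` of period `L^{j+1}` with zero period sum and a potential
`Λ` depending on `x_{i₁}` only with period `L^{j+1}` in `x_{i₁}`, the direction `slabWave s E + gaugeDir 1 Λ` is tangent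
at the flat configuration to the fibre of the `(j+1)`-fold average: `TangentIter L j flatCfg`. [folklore] -/
theorem tangentIter_flatCfg_slabWave_add_gaugeDir {L : ℕ} (hL : 1 ≤ L) {i₀ i₁ : Fin d} (h01 : i₀ ≠ i₁) (E : Matrix n n ℂ) :
    ∀ (j : ℕ) (s : ℤ → ℝ) (Λ : Site d → Matrix n n ℂ),
      (∀ t, s (t + (L : ℤ) ^ (j + 1)) = s t) →
      (∑ t ∈ Finset.range (L ^ (j + 1)), s (t : ℤ) = 0) →
      (∀ (z v : Site d), v i₁ = 0 → Λ (z + v) = Λ z) →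
      (∀ z : Site d, Λ (z + ((L : ℤ) ^ (j + 1)) • e i₁) = Λ z) →
      TangentIter L j flatCfg (slabWave i₀ i₁ s E + gaugeDir (flatCfg (d := d) (n := n)) Λ)
  | 0, s, Λ, hs, hsum, hΛ, hΛp => by
      -- the one-fold average vanishes
      show cpush L flatCfg (slabWave i₀ i₁ s E + gaugeDir flatCfg Λ) = 0
      rw [cpush_flatCfg_add L hL, cpush_flatCfg_slabWave L hL h01, cpush_flatCfg_gaugeDir L hL]
      have hL1 : (L : ℤ) ^ (0 + 1) = L := by simp
      rw [hL1] at hs hΛp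
      -- the block sums of an `L`-periodic zero-sum profile vanish
      have hb : ∀ u, bsum L s u = 0 := by
        intro u
        unfold bsum
        rw [show (∑ t ∈ Finset.range L, s ((L : ℤ) * u + (t : ℤ))) = ∑ t ∈ Finset.range L, s (t : ℤ) from
          Finset.sum_congr rfl fun t _ => by
            rw [show (L : ℤ) * u + (t : ℤ) = (t : ℤ) + u * (L : ℤ) by ring, shift_mul_period hs]]
        simpa using hsum
      rw [slabWave_zero_profile i₀ i₁ E hb, zero_add]
      -- the total potential is constant, so its gauge direction vanishes
      funext z κ
      have hconst := const_of_shift_and_periodic_one i₁ (fun y => framePot L i₀ i₁ s E y + Λ ((L : ℤ) • y))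
        (fun z v hv => by
          rw [framePot_shift L i₀ i₁ s E z hv, smul_add, hΛ _ _ (by simp [hv])])
        (fun z => by
          rw [framePot_periodic L i₀ i₁ (m := 1) (fun t => by rw [mul_one]; exact hs t) E z, smul_add, smul_smul,
            mul_one, hΛp])
        z κ
      simp only [Pi.add_apply, Pi.zero_apply, gaugeDir_flatCfg]
      rw [show framePot L i₀ i₁ s E z - framePot L i₀ i₁ s E (z + e κ) + (Λ ((L : ℤ) • z) - Λ ((L : ℤ) • (z + e κ)))
          = (framePot L i₀ i₁ s E z + Λ ((L : ℤ) • z))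
            - (framePot L i₀ i₁ s E (z + e κ) + Λ ((L : ℤ) • (z + e κ))) by abel,
        hconst, sub_self]
  | j + 1, s, Λ, hs, hsum, hΛ, hΛp => by
      show TangentIter L j (cavg L flatCfg) (cpush L flatCfg (slabWave i₀ i₁ s E + gaugeDir flatCfg Λ))
      have hsplit : gaugeDir flatCfg (framePot L i₀ i₁ s E) + gaugeDir flatCfg (fun y => Λ ((L : ℤ) • y))
          = gaugeDir (flatCfg (d := d) (n := n)) (fun y => framePot L i₀ i₁ s E y + Λ ((L : ℤ) • y)) := by
        funext z κ; simp only [Pi.add_apply, gaugeDir_flatCfg]; abel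
      rw [cavg_flatCfg, cpush_flatCfg_add L hL, cpush_flatCfg_slabWave L hL h01, cpush_flatCfg_gaugeDir L hL, add_assoc,
        hsplit]
      have hLm : (L : ℤ) ^ (j + 1 + 1) = (L : ℤ) * (L : ℤ) ^ (j + 1) := by ring
      refine tangentIter_flatCfg_slabWave_add_gaugeDir hL h01 E j (bsum L s) _ ?_ ?_ ?_ ?_
      · intro u
        exact bsum_periodic L (m := (L : ℤ) ^ (j + 1)) (fun t => by rw [← hLm]; exact hs t) u
      · rw [sum_range_bsum, ← pow_succ', hsum]
      · intro z v hv
        show framePot L i₀ i₁ s E (z + v) + Λ ((L : ℤ) • (z + v)) = framePot L i₀ i₁ s E z + Λ ((L : ℤ) • z)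
        rw [framePot_shift L i₀ i₁ s E z hv, smul_add, hΛ _ _ (by simp [hv])]
      · intro z
        show framePot L i₀ i₁ s E (z + ((L : ℤ) ^ (j + 1)) • e i₁) + Λ ((L : ℤ) • (z + ((L : ℤ) ^ (j + 1)) • e i₁))
          = framePot L i₀ i₁ s E z + Λ ((L : ℤ) • z)
        rw [framePot_periodic L i₀ i₁ (m := (L : ℤ) ^ (j + 1)) (fun t => by rw [← hLm]; exact hs t) E z, smul_add,
          smul_smul, ← hLm, hΛp]

/-- **SLAB WAVES ARE CONSTRAINT-TANGENT AT THE FLAT BACKGROUND.**  For every `k ≥ 1`, every profile `s` of period `L^k`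
with zero period sum, and every matrix `E`, the slab wave `X(x,μ) = [μ = i₀]·s(x_{i₁})·E` is tangent at the flat
configuration to the fibre of run A's `k`-fold averaging constraint: `TangentIter L (k−1) flatCfg X` (B11's `T = ker DQ̄_k`
at `U₀ = 1`). [cite: Balaban1985Variational, (83) p.290] -/
theorem tangentIter_flatCfg_slabWave {L : ℕ} (hL : 1 ≤ L) {i₀ i₁ : Fin d} (h01 : i₀ ≠ i₁) (E : Matrix n n ℂ) {k : ℕ} (hk : 1 ≤ k)
    {s : ℤ → ℝ} (hs : ∀ t, s (t + (L : ℤ) ^ k) = s t) (hsum : ∑ t ∈ Finset.range (L ^ k), s (t : ℤ) = 0) :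
    TangentIter L (k - 1) flatCfg (slabWave i₀ i₁ s E) := by
  obtain ⟨j, rfl⟩ : ∃ j, k = j + 1 := ⟨k - 1, by omega⟩
  rw [Nat.add_sub_cancel]
  have h := tangentIter_flatCfg_slabWave_add_gaugeDir hL h01 E j s (fun _ => 0) hs hsum (fun _ _ _ => rfl) (fun _ => rfl)
  have h0 : gaugeDir (flatCfg (d := d) (n := n)) (fun _ => (0 : Matrix n n ℂ)) = 0 := by
    funext z κ; simp [gaugeDir_flatCfg]
  simpa [h0] using h

end

end Summit.QuantumFields.BalabanUV.T4Continuum.NE3TangentFlatPush
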